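import Summits.ResolutionOfSingularities.ResolutionOfSingularities.Theorems.FrobeniusLadderFRationalResolutionCharacteristicTower
import HarnessLib

/-!
# Crux `FrobeniusLadder.FRationalResolution` (stmt-ResolutionOfSingularities-15317), line `redirect`,
# stub `stub_diagonalizableQuotientResolution` — CHARACTERISTIC TOWERS OF ANY LENGTH ARE BLOW-UPS OF ONE CHARACTERISTIC IDEAL
# (iterating `…CharacteristicTower.exists_characteristic_ideal_of_tower`: arbitrary blow-up models, then `n` steps)

`…CharacteristicTower` (p839014) packages `Bl_𝒦(Bl_{J₁}(Spec R)) → Spec R` into `Bl_{J₂}(Spec R)` with `J₂` characteristic, for the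
MODEL `affineBlowup J₁`. To iterate one needs the same statement for an ARBITRARY blowing up `p : X₁ → Spec R` of `J₁` (the top of
the previous step is only isomorphic to the model), which is obtained here by transport along the uniqueness isomorphism; then an
induction gives the `n`-step form: a tower `X_n → ⋯ → X_1 → X_0 → Spec R` of blowing ups whose successive centres `𝒦_i` on `X_i`
are stable under the automorphisms of `X_i` covering automorphisms of `Spec R` (e.g. reduced singular loci, `…CharacteristicTowerCentre`)
is the blowing up of ONE characteristic ideal `J_n`, with `𝔪^c ⊆ J_n ⊆ J_0` when the centres are supported over `V(𝔪)`. This is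
the shape needed by intrinsic resolution recipes with more than one conifold-type step (MEMO-15317-leafhand2-g16 §2(e)(iv): in
dimension `≥ 4` the intrinsic class-group centre leaves non-simplicial cones, so further intrinsic steps are required).

* `exists_characteristic_ideal_of_tower'` — the two-step theorem for an arbitrary blowing up `p : X₁ → Spec R` in `J₁~`;
* ★ `exists_characteristic_ideal_of_itower` — the `n`-step theorem (data: `X : ℕ → Scheme`, `q i : X i → Spec R`, `π i : X (i+1) → X i`
  blowing up `𝒦 i` with `π i ≫ q i = q (i+1)`, `q 0` a blowing up in a characteristic `J₀ ⊇ 𝔪ᵃ`, `𝒦 i ⊇ (q i)⁻¹(𝔪^{b i})~`);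
* `exists_characteristic_ideal_isRegular_of_itower` — with a regular top `X n`: a characteristic `J ⊇ 𝔪ᶜ`, `J ≠ ⊤`, `Bl_J(Spec R)`
  regular — the input of `…GaloisCharacteristicCentre.hloc_of_characteristic_ideal_adicCompletion` (p838347).

Honest label: plumbing toward ONE leaf stub (no stub, crux or summit closed). No definitions, no named facts, no sorry.
[cite: StacksProject, Tag 080A; Tag 080B] [cite: GortzWedhorn2020, Prop. 13.91] [folklore]
-/

noncomputable section

-- single-problem summit: the doubled namespace component is forced
set_option linter.dupNamespace false

open CategoryTheory CategoryTheory.Limits AlgebraicGeometry TopologicalSpace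
open Literature.AlgebraicGeometry.Resolution
open Summit.ResolutionOfSingularities.ResolutionOfSingularities.Theorems.FRationalResolution

namespace Summit.ResolutionOfSingularities.ResolutionOfSingularities.Theorems.FRationalResolution.CharacteristicTowerIterate

/-! ## §1 Arbitrary blow-up models -/

/-- **The two-step packaging theorem for an arbitrary blowing up `p : X₁ → Spec R` in `J₁~`** (transport of
`…CharacteristicTower.exists_characteristic_ideal_of_tower` along the uniqueness isomorphism `X₁ ≅ Bl_{J₁}(Spec R)`).
[cite: StacksProject, Tag 080B] [cite: GortzWedhorn2020, Prop. 13.91 (1)] -/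
theorem exists_characteristic_ideal_of_tower' {R : Type} [CommRing R] [IsNoetherianRing R]
    (J₁ : Ideal R) (hJ₁ : ∀ θ : R ≃+* R, J₁.map (θ : R →+* R) ≤ J₁)
    {X₁ : Scheme.{0}} (p : X₁ ⟶ Spec (.of R)) (hp : IsBlowup p (affineBlowup.idealSheaf J₁))
    (𝒦 : X₁.IdealSheafData)
    (h𝒦 : ∀ Θ : X₁ ≅ X₁, (∃ σ : Spec (.of R) ⟶ Spec (.of R), Θ.hom ≫ p = p ≫ σ) → 𝒦.comap Θ.hom ≤ 𝒦)
    {X₂ : Scheme.{0}} (p' : X₂ ⟶ X₁) (hp' : IsBlowup p' 𝒦) :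
    ∃ (J₂ : Ideal R) (d : ℕ), (∀ θ : R ≃+* R, J₂.map (θ : R →+* R) ≤ J₂) ∧ J₂ ≤ J₁ ∧
      IsBlowup (p' ≫ p) (affineBlowup.idealSheaf J₂) ∧
      ∀ M : Ideal R, (affineBlowup.idealSheaf M).comap p ≤ 𝒦 → J₁ ^ (d + 1) * M ≤ J₂ := by
  -- the uniqueness isomorphism with the model
  obtain ⟨e, he, he'⟩ := hp.unique (affineBlowup.isBlowup J₁)
  -- transported centre and second blowing up
  have hp'' : IsBlowup (p' ≫ e.hom) (𝒦.comap e.inv) := hp'.comp_iso e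
  have h𝒦' : ∀ Θ : affineBlowup J₁ ≅ affineBlowup J₁,
      (∃ σ : Spec (.of R) ⟶ Spec (.of R), Θ.hom ≫ affineBlowup.π J₁ = affineBlowup.π J₁ ≫ σ) →
      (𝒦.comap e.inv).comap Θ.hom ≤ 𝒦.comap e.inv := by
    rintro Θ ⟨σ, hσ⟩
    have hΘ : (e ≪≫ Θ ≪≫ e.symm).hom ≫ p = p ≫ σ := by
      simp only [Iso.trans_hom, Iso.symm_hom, Category.assoc]
      rw [he', hσ, ← Category.assoc, he]
    have h : (𝒦.comap (e ≪≫ Θ ≪≫ e.symm).hom).comap e.inv ≤ 𝒦.comap e.inv :=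
      Scheme.IdealSheafData.comap_mono e.inv (h𝒦 (e ≪≫ Θ ≪≫ e.symm) ⟨σ, hΘ⟩)
    rw [← Scheme.IdealSheafData.comap_comp] at h
    simp only [Iso.trans_hom, Iso.symm_hom, e.inv_hom_id_assoc] at h
    rwa [Scheme.IdealSheafData.comap_comp] at h
  obtain ⟨J₂, d, hchar, hle, hbl, hprim⟩ :=
    CharacteristicTower.exists_characteristic_ideal_of_tower J₁ hJ₁ (𝒦.comap e.inv) h𝒦' (p' ≫ e.hom) hp''
  refine ⟨J₂, d, hchar, hle, ?_, fun M hM => hprim M ?_⟩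
  · rwa [Category.assoc, he] at hbl
  · have h : ((affineBlowup.idealSheaf M).comap p).comap e.inv ≤ 𝒦.comap e.inv :=
      Scheme.IdealSheafData.comap_mono e.inv hM
    rwa [← Scheme.IdealSheafData.comap_comp, he'] at h

/-! ## §2 Towers of any length -/

/-- ★ **An `n`-step characteristic tower is the blowing up of one characteristic ideal.** Data: `X : ℕ → Scheme` with structure
maps `q i : X i → Spec R` and blowing ups `π i : X (i+1) → X i` in centres `𝒦 i` (`π i ≫ q i = q (i+1)`); `q 0` is a blowing up
in a characteristic ideal `J₀` with `𝔪ᵃ ⊆ J₀`; each `𝒦 i` contains `(q i)⁻¹((𝔪^{b i})~)` and is stable under the automorphisms of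
`X i` covering (along `q i`) automorphisms of `Spec R`. Then for every `n`, `q n` is a blowing up of `Spec R` in a characteristic
ideal `J ⊆ J₀` containing a power of `𝔪`. [cite: StacksProject, Tag 080B] [folklore] -/
theorem exists_characteristic_ideal_of_itower {R : Type} [CommRing R] [IsNoetherianRing R] (𝔪 J₀ : Ideal R) {a : ℕ}
    (ha : 𝔪 ^ a ≤ J₀) (hJ₀ : ∀ θ : R ≃+* R, J₀.map (θ : R →+* R) ≤ J₀)
    (X : ℕ → Scheme.{0}) (q : ∀ i, X i ⟶ Spec (.of R)) (hq0 : IsBlowup (q 0) (affineBlowup.idealSheaf J₀))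
    (𝒦 : ∀ i, (X i).IdealSheafData) (π : ∀ i, X (i + 1) ⟶ X i) (hπ : ∀ i, IsBlowup (π i) (𝒦 i))
    (hcomp : ∀ i, π i ≫ q i = q (i + 1))
    (h𝒦 : ∀ i, ∀ Θ : X i ≅ X i, (∃ σ : Spec (.of R) ⟶ Spec (.of R), Θ.hom ≫ q i = q i ≫ σ) → (𝒦 i).comap Θ.hom ≤ 𝒦 i)
    (b : ℕ → ℕ) (hb : ∀ i, (affineBlowup.idealSheaf (𝔪 ^ b i)).comap (q i) ≤ 𝒦 i) (n : ℕ) :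
    ∃ (J : Ideal R) (c : ℕ), (∀ θ : R ≃+* R, J.map (θ : R →+* R) ≤ J) ∧ J ≤ J₀ ∧ 𝔪 ^ c ≤ J ∧
      IsBlowup (q n) (affineBlowup.idealSheaf J) := by
  induction n with
  | zero => exact ⟨J₀, a, hJ₀, le_rfl, ha, hq0⟩
  | succ n ih =>
    obtain ⟨J, c, hchar, hle, hc, hbl⟩ := ih
    obtain ⟨J', d, hchar', hle', hbl', hprim⟩ :=
      exists_characteristic_ideal_of_tower' J hchar (q n) hbl (𝒦 n) (h𝒦 n) (π n) (hπ n)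
    refine ⟨J', c * (d + 1) + b n, hchar', hle'.trans hle, ?_, by rwa [hcomp n] at hbl'⟩
    calc 𝔪 ^ (c * (d + 1) + b n) = (𝔪 ^ c) ^ (d + 1) * 𝔪 ^ b n := by rw [pow_add, pow_mul]
      _ ≤ J ^ (d + 1) * 𝔪 ^ b n := Ideal.mul_mono_left (Ideal.pow_right_mono hc _)
      _ ≤ J' := hprim _ (hb n)

/-- **With a regular top.** In the situation of `exists_characteristic_ideal_of_itower`, if moreover `J₀ ≠ ⊤` and `X n` is regular,
there is a characteristic ideal `J` with `𝔪ᶜ ⊆ J`, `J ≠ ⊤` and `Bl_J(Spec R)` regular — the one-ideal input of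
`…GaloisCharacteristicCentre.hloc_of_characteristic_ideal_adicCompletion` (p838347) and
`…GaloisCharacteristicCentreGlobal.hasResolution_of_characteristic_ideals_adicCompletion` (p838474). [folklore] -/
theorem exists_characteristic_ideal_isRegular_of_itower {R : Type} [CommRing R] [IsNoetherianRing R] (𝔪 J₀ : Ideal R) {a : ℕ}
    (ha : 𝔪 ^ a ≤ J₀) (hJ₀top : J₀ ≠ ⊤) (hJ₀ : ∀ θ : R ≃+* R, J₀.map (θ : R →+* R) ≤ J₀)
    (X : ℕ → Scheme.{0}) (q : ∀ i, X i ⟶ Spec (.of R)) (hq0 : IsBlowup (q 0) (affineBlowup.idealSheaf J₀))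
    (𝒦 : ∀ i, (X i).IdealSheafData) (π : ∀ i, X (i + 1) ⟶ X i) (hπ : ∀ i, IsBlowup (π i) (𝒦 i))
    (hcomp : ∀ i, π i ≫ q i = q (i + 1))
    (h𝒦 : ∀ i, ∀ Θ : X i ≅ X i, (∃ σ : Spec (.of R) ⟶ Spec (.of R), Θ.hom ≫ q i = q i ≫ σ) → (𝒦 i).comap Θ.hom ≤ 𝒦 i)
    (b : ℕ → ℕ) (hb : ∀ i, (affineBlowup.idealSheaf (𝔪 ^ b i)).comap (q i) ≤ 𝒦 i) (n : ℕ) (hreg : Scheme.IsRegular (X n)) :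
    ∃ (J : Ideal R) (c : ℕ), (∀ θ : R ≃+* R, J.map (θ : R →+* R) ≤ J) ∧ 𝔪 ^ c ≤ J ∧ J ≠ ⊤ ∧
      Scheme.IsRegular (affineBlowup J) := by
  obtain ⟨J, c, hchar, hle, hc, hbl⟩ :=
    exists_characteristic_ideal_of_itower 𝔪 J₀ ha hJ₀ X q hq0 𝒦 π hπ hcomp h𝒦 b hb n
  exact ⟨J, c, hchar, hc, fun h => hJ₀top (top_le_iff.mp (h ▸ hle)),
    CharacteristicTower.isRegular_affineBlowup_of_isBlowup hbl hreg⟩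

end Summit.ResolutionOfSingularities.ResolutionOfSingularities.Theorems.FRationalResolution.CharacteristicTowerIterate

end
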